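import Summits.KontsevichZagierPeriods.Zeta5Search.Zudilin2002CasoratianRates
import HarnessLib

/-!
# ζ(5) search — Zudilin 2002: Theorem 1's rates from the two identifications alone (cell `pub-zeta5`, TYPER)

HONEST FRAMING: systematic search; no irrationality claim unless certified.

Last part of the kernel-certified study of Zudilin's third-order `ζ(5)` recursion. The tree cites
Zudilin's Theorem 1, eqs. (4)–(5), as the named fact `Zudilin2002.theorem1_rates` (five limits). The
three GROWTH limits are theorems since `Zudilin2002ExactRates.lean`; `Zudilin2002CasoratianRates.lean`
proved the DECAY of `qₙL - pₙ` (`L = lim pₙ/qₙ`) at the rate `log ν - log|μ₃|` with `ν` the dominant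
root of the Casoratian equation `y³ = 752y² + 37888y - 256`. Here:

* `charPoly_root_one` — the third root `μ₁ ∈ (-0.02001513, -0.02001512)` of Zudilin's (5) (IVT);
* `vieta` — for three distinct roots of `x³ + 2368x² - 752x - 16`: `Σμᵢ = -2368`, `Σμᵢμⱼ = -752`,
  `μ₁μ₂μ₃ = 16`; hence `casChar_factor` — `y³ - 752y² - 37888y + 256 = ∏(y + μᵢμⱼ)` (the Casoratian
  equation IS the second compound), and `nu_eq` — the dominant Casoratian root is `ν = -μ₂μ₃ = μ₂|μ₃|`,
  so `log ν - log|μ₃| = log μ₂` EXACTLY (`log_nu_sub`);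
* `theorem1_rates_of_tendsto` — **if `pₙ/qₙ → ζ(5)` and `p̃ₙ/qₙ → ζ(3)` then `theorem1_rates`**:
  all five limits of Zudilin's Theorem 1 follow from the two identifications of the limits (the
  genuinely analytic content: the hypergeometric construction of Sect. 2), by Poincaré + Abel + the
  tail squeeze. Everything else in (4)–(5) is now arithmetic of the recursion, PROVED (0 sorry).
-/

noncomputable section

open Filter Topology Finset Set
open Literature.NumberTheory.Irrationality.Zudilin2002
open Literature.NumberTheory.Transcendental
open Literature.Analysis.Asymptotics.PoincareRecurrence

namespace Summit.KontsevichZagierPeriods.Zeta5Search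

namespace Zudilin2002Growth

/-! ### The three roots of (5) and Vieta -/

/-- The root `μ₁ ∈ (-0.02001513, -0.02001512)` of `μ³ + 2368μ² - 752μ - 16` (IVT on the printed bracket). -/
theorem charPoly_root_one :
    ∃ μ : ℝ, μ ∈ Ioo (-2001513 / 10 ^ 8 : ℝ) (-2001512 / 10 ^ 8) ∧ charPoly μ = 0 := by
  have hcont : Continuous (fun x : ℝ => charPoly x) := by unfold charPoly; fun_prop
  have hab : (-2001513 / 10 ^ 8 : ℝ) ≤ -2001512 / 10 ^ 8 := by norm_num
  have ha : (0 : ℝ) < charPoly (-2001513 / 10 ^ 8 : ℝ) := by unfold charPoly; norm_num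
  have hb : charPoly (-2001512 / 10 ^ 8 : ℝ) < 0 := by unfold charPoly; norm_num
  obtain ⟨x, hx, hx0⟩ := intermediate_value_Ioo' hab hcont.continuousOn ⟨hb, ha⟩
  exact ⟨x, hx, hx0⟩

/-- **Vieta for (5)**: three pairwise distinct roots of `x³ + 2368x² - 752x - 16` have
`r₁ + r₂ + r₃ = -2368`, `r₁r₂ + r₁r₃ + r₂r₃ = -752`, `r₁r₂r₃ = 16`. -/
theorem vieta {r₁ r₂ r₃ : ℝ} (h1 : charPoly r₁ = 0) (h2 : charPoly r₂ = 0) (h3 : charPoly r₃ = 0)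
    (h12 : r₁ ≠ r₂) (h13 : r₁ ≠ r₃) (h23 : r₂ ≠ r₃) :
    r₁ + r₂ + r₃ = -2368 ∧ r₁ * r₂ + r₁ * r₃ + r₂ * r₃ = -752 ∧ r₁ * r₂ * r₃ = 16 := by
  unfold charPoly at h1 h2 h3
  -- divided differences
  have q12 : r₁ ^ 2 + r₁ * r₂ + r₂ ^ 2 + 2368 * (r₁ + r₂) - 752 = 0 := by
    have e : (r₁ - r₂) * (r₁ ^ 2 + r₁ * r₂ + r₂ ^ 2 + 2368 * (r₁ + r₂) - 752) = 0 := by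
      linear_combination h1 - h2
    exact (mul_eq_zero.1 e).resolve_left (sub_ne_zero.2 h12)
  have q13 : r₁ ^ 2 + r₁ * r₃ + r₃ ^ 2 + 2368 * (r₁ + r₃) - 752 = 0 := by
    have e : (r₁ - r₃) * (r₁ ^ 2 + r₁ * r₃ + r₃ ^ 2 + 2368 * (r₁ + r₃) - 752) = 0 := by
      linear_combination h1 - h3
    exact (mul_eq_zero.1 e).resolve_left (sub_ne_zero.2 h13)
  have e1 : r₁ + r₂ + r₃ = -2368 := by
    have e : (r₂ - r₃) * (r₁ + r₂ + r₃ + 2368) = 0 := by linear_combination q12 - q13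
    have := (mul_eq_zero.1 e).resolve_left (sub_ne_zero.2 h23)
    linarith
  have e2 : r₁ * r₂ + r₁ * r₃ + r₂ * r₃ = -752 := by
    have hr3 : r₃ = -2368 - r₁ - r₂ := by linarith
    rw [hr3]
    linear_combination -q12
  refine ⟨e1, e2, ?_⟩
  have hr3 : r₃ = -2368 - r₁ - r₂ := by linarith
  rw [hr3] at e2 ⊢
  linear_combination r₁ * e2 + h1

/-- **The Casoratian equation is the second compound of (5)**:
`y³ - 752y² - 37888y + 256 = (y + μ₁μ₂)(y + μ₁μ₃)(y + μ₂μ₃)` for the three roots. -/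
theorem casChar_factor {r₁ r₂ r₃ : ℝ} (h1 : charPoly r₁ = 0) (h2 : charPoly r₂ = 0)
    (h3 : charPoly r₃ = 0) (h12 : r₁ ≠ r₂) (h13 : r₁ ≠ r₃) (h23 : r₂ ≠ r₃) (y : ℝ) :
    y ^ 3 - 752 * y ^ 2 - 37888 * y + 256 = (y + r₁ * r₂) * (y + r₁ * r₃) * (y + r₂ * r₃) := by
  obtain ⟨e1, e2, e3⟩ := vieta h1 h2 h3 h12 h13 h23
  have expand : (y + r₁ * r₂) * (y + r₁ * r₃) * (y + r₂ * r₃) =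
      y ^ 3 + (r₁ * r₂ + r₁ * r₃ + r₂ * r₃) * y ^ 2 + (r₁ * r₂ * r₃) * (r₁ + r₂ + r₃) * y +
        (r₁ * r₂ * r₃) ^ 2 := by ring
  rw [expand, e1, e2, e3]
  ring

/-- **The dominant Casoratian root is `μ₂|μ₃|`**: if `ν ∈ (799.39, 799.40)` solves the Casoratian
equation and `μ₁, μ₂, μ₃` are the roots of (5) in their printed brackets, then `ν = -μ₂μ₃`. -/
theorem nu_eq {ν μ₁ μ₂ μ₃ : ℝ} (hν : ν ^ 3 = 752 * ν ^ 2 + 37888 * ν + (-256))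
    (hνb : ν ∈ Ioo (79939 / 100 : ℝ) (79940 / 100))
    (h1 : charPoly μ₁ = 0) (hb1 : μ₁ ∈ Ioo (-2001513 / 10 ^ 8 : ℝ) (-2001512 / 10 ^ 8))
    (h2 : charPoly μ₂ = 0) (hb2 : μ₂ ∈ Ioo (33753726 / 10 ^ 8 : ℝ) (33753727 / 10 ^ 8))
    (h3 : charPoly μ₃ = 0) (hb3 : μ₃ ∈ Ioo (-236831752214 / 10 ^ 8 : ℝ) (-236831752213 / 10 ^ 8)) :
    ν = -(μ₂ * μ₃) := by
  obtain ⟨hν1, hν2⟩ := hνb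
  obtain ⟨ha1, hb1⟩ := hb1
  obtain ⟨ha2, hb2⟩ := hb2
  obtain ⟨ha3, hb3⟩ := hb3
  have h12 : μ₁ ≠ μ₂ := by intro h; rw [h] at ha1 hb1; linarith
  have h13 : μ₁ ≠ μ₃ := by intro h; rw [h] at ha1 hb1; linarith
  have h23 : μ₂ ≠ μ₃ := by intro h; rw [h] at ha2 hb2; linarith
  have hf := casChar_factor h1 h2 h3 h12 h13 h23 ν
  have h0 : (ν + μ₁ * μ₂) * (ν + μ₁ * μ₃) * (ν + μ₂ * μ₃) = 0 := by rw [← hf]; linarith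
  -- the first two factors are positive
  have hp1 : 0 < ν + μ₁ * μ₂ := by nlinarith
  have hp2 : 0 < ν + μ₁ * μ₃ := by nlinarith
  rcases mul_eq_zero.1 h0 with h | h
  · rcases mul_eq_zero.1 h with h' | h'
    · linarith
    · linarith
  · linarith

/-- Hence `log ν - log|μ₃| = log μ₂`. -/
theorem log_nu_sub {ν μ₂ μ₃ : ℝ} (hν : ν = -(μ₂ * μ₃)) (h2 : 0 < μ₂) (h3 : μ₃ < 0) :
    Real.log ν - Real.log |μ₃| = Real.log μ₂ := by
  have e : ν = μ₂ * |μ₃| := by rw [hν, abs_of_neg h3]; ring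
  rw [e, Real.log_mul h2.ne' (abs_pos.2 h3.ne).ne']
  ring

/-! ### Theorem 1 from the identifications -/

/-- **Zudilin 2002, Theorem 1 (4)–(5) from the two identifications.** If `pₙ/qₙ → ζ(5)` and
`p̃ₙ/qₙ → ζ(3)` (the analytic content of the construction), then ALL of `theorem1_rates` holds:
`log|ℓₙ|/n, log|ℓ̃ₙ|/n → log μ₂` and `log|qₙ|/n, log|pₙ|/n, log|p̃ₙ|/n → log|μ₃|`. -/
theorem theorem1_rates_of_tendsto
    (h5 : Tendsto (fun n : ℕ => (p n : ℝ) / q n) atTop (𝓝 (zetaValue 5)))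
    (h3 : Tendsto (fun n : ℕ => (ptilde n : ℝ) / q n) atTop (𝓝 (zetaValue 3))) :
    theorem1_rates := by
  obtain ⟨⟨μ₂, hb2, hμ₂⟩, ⟨μ₃, hb3, hμ₃⟩⟩ := charPoly_roots
  obtain ⟨μ₁, hb1, hμ₁⟩ := charPoly_root_one
  obtain ⟨ν, hνb, hν⟩ := casChar_root
  have hle : μ₃ ≤ -796 := by linarith [hb3.2]
  have hge : (195 : ℝ) ≤ ν := by linarith [hνb.1]
  have hνeq := nu_eq hν hνb hμ₁ hb1 hμ₂ hb2 hμ₃ hb3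
  have hμ₂pos : 0 < μ₂ := lt_trans (by norm_num) hb2.1
  have hμ₃neg : μ₃ < 0 := lt_trans hb3.2 (by norm_num)
  have hlog := log_nu_sub hνeq hμ₂pos hμ₃neg
  refine ⟨μ₂, μ₃, hμ₂, hb2, hμ₃, hb3, ?_, ?_, tendsto_log_abs_q_div hμ₃ hle,
    tendsto_log_abs_p_div hμ₃ hle, tendsto_log_abs_ptilde_div hμ₃ hle⟩
  · have h := tendsto_log_abs_form_div_of_tendsto h5 hν hge hμ₃ hle
    rw [hlog] at h
    exact h
  · have h := tendsto_log_abs_form_tilde_div_of_tendsto h3 hν hge hμ₃ hle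
    rw [hlog] at h
    exact h

/-- **Unconditional**: the exact approximation rate of Zudilin's approximants to THEIR limit `L`
(which exists, `exists_limit`; `L = ζ(5)` is the cited identification):
`log|L - pₙ/qₙ|/n → log μ₂ - log|μ₃| = -8.856014…` with `μ₂, μ₃` THE roots of (5) in Zudilin's brackets. -/
theorem tendsto_log_abs_sub_div :
    ∃ L μ₂ μ₃ : ℝ, Tendsto (fun n : ℕ => (p n : ℝ) / q n) atTop (𝓝 L) ∧
      charPoly μ₂ = 0 ∧ μ₂ ∈ Ioo (33753726 / 10 ^ 8 : ℝ) (33753727 / 10 ^ 8) ∧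
      charPoly μ₃ = 0 ∧ μ₃ ∈ Ioo (-236831752214 / 10 ^ 8 : ℝ) (-236831752213 / 10 ^ 8) ∧
      Tendsto (fun n : ℕ => Real.log |L - (p n : ℝ) / q n| / n) atTop
        (𝓝 (Real.log μ₂ - Real.log |μ₃|)) := by
  obtain ⟨L, hL, -⟩ := exists_limit
  obtain ⟨⟨μ₂, hb2, hμ₂⟩, ⟨μ₃, hb3, hμ₃⟩⟩ := charPoly_roots
  obtain ⟨μ₁, hb1, hμ₁⟩ := charPoly_root_one
  obtain ⟨ν, hνb, hν⟩ := casChar_root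
  have hle : μ₃ ≤ -796 := by linarith [hb3.2]
  have hge : (195 : ℝ) ≤ ν := by linarith [hνb.1]
  have hνeq := nu_eq hν hνb hμ₁ hb1 hμ₂ hb2 hμ₃ hb3
  have hμ₂pos : 0 < μ₂ := lt_trans (by norm_num) hb2.1
  have hμ₃neg : μ₃ < 0 := lt_trans hb3.2 (by norm_num)
  have hlog := log_nu_sub hνeq hμ₂pos hμ₃neg
  refine ⟨L, μ₂, μ₃, hL, hμ₂, hb2, hμ₃, hb3, ?_⟩
  have h := tendsto_log_abs_sub_div_of_tendsto hL hν hge hμ₃ hle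
  have e : Real.log ν - 2 * Real.log |μ₃| = Real.log μ₂ - Real.log |μ₃| := by linarith
  rw [e] at h
  exact h

end Zudilin2002Growth

end Summit.KontsevichZagierPeriods.Zeta5Search
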